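import Literature.AnabelianGeometry.SemiGraphs.MetabelianLeafStarElevLevels
import Literature.AnabelianGeometry.SemiGraphs.TemperedPiRayApartment
import Literature.AnabelianGeometry.SemiGraphs.TemperedPiPointStabilizerCore
import Literature.AnabelianGeometry.SemiGraphs.TemperedPiCompactnessCriterion
import Literature.AnabelianGeometry.SemiGraphs.TemperedPiChartExists
import Literature.AnabelianGeometry.SemiGraphs.TemperedPiPresentationInputs
import Literature.AnabelianGeometry.SemiGraphs.TemperedPiBranchStabilizerRecentred
import Literature.AnabelianGeometry.SemiGraphs.UniformSplittingStrictlyCoherentProofs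
import HarnessLib

/-!
# The escaping element of `π₁^temp(𝒢⋆(p))` («RAYLESS-STAR·CIV-NEG», brick S5c)

Mochizuki, *Semi-graphs of anabelioids*, Publ. RIMS **42** (2006), §3, Prop. 3.6 p. 38, Thm. 3.7 (i), (iii)
pp. 40–41 [cite: MochizukiSemiAnbd2006, Thm 3.7(iii) p.41]; the claim under test is the ∀-countable typing
`CompactInVerticialAt` of Thm 3.7 (iii) at the RAYLESS star `𝒢⋆(p) = metabelianLeafStar p` (hypotheses of
Thm 3.7 discharged: `metabelianLeafStar_thm37Hypotheses'`).

Construction file (abc-iut cell, layer L3, row «RAYLESS-STAR·CIV-NEG», seat abc-iut-L3-t8 gen 6; desk memo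
VERTICAL-ESCAPE-RAYLESS-STAR-L3t8g6.md §3).  In the tempered fundamental group `Π := π₁^temp(𝒢⋆(p))` of the
canonical chart, with its Galois tower `D`: a compatible point sequence `P₀` over the centre, the LEAF
sequences `P_n := glue_{(n,false)} (unglue_{(n,true)} P₀)` over the leaves (so that
`ψ_{P_n} ∘ lowHom n = ψ_{P₀} ∘ θα p n`, `leafSeq_decompHom_lowHom`), and the elements
`y := ψ_{P₀}(a)`, `m_n := ψ_{P_n}(transl)`, `h_k := m_0 m_1 ⋯ m_k`, `c_k := h_k y h_k⁻¹` (`escY`, `escM`, `escH`,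
`escC`).  MAIN RESULTS: the level-wise eventual constancy **`proj_escC_succ`** (`ρ_j(c_{k+1}) = ρ_j(c_k)` for
`k + 1 ≥ N_j := #(S_j)_{centre}`, by the engine `transl·sig·transl⁻¹ = transl^{-p^{n+1}}·sig` of
`IwahoriMetabelianLeaves.lean` and the UNIFORM vanishing `gal_apply_ofAdd_pow_mul_eq_one` of `p^{N_j}`-th
powers at level `j`), the finite order of the `ρ_j(c_k)`, and hence (abc-iut-L3-d4's completeness /
compactness criteria) **`exists_escapeLimit`**: an element `c = lim c_k ∈ Π` generating a COMPACT procyclic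
subgroup, acting at every level `j` like `c_k`, `k ≥ N_j`.  The non-verticiality of `⟨c⟩‾` is the next file.
No named fact; no side taken on [IUTchIII] Cor 3.12.
-/

noncomputable section

open CategoryTheory Topology Multiplicative

namespace Literature.AnabelianGeometry.SemiGraphs

open IwahoriWitness

namespace ProfiniteSemiGraph

/-! ### A uniform vanishing lemma at a level -/

namespace GaloisLevelData.PointSeq

universe u

variable {p : ℕ} [hp : Fact p.Prime] {𝒢 : ProfiniteSemiGraph.{u}} {D : GaloisLevelData 𝒢}
  {h𝒢 : 𝒢.IsCountable} {w : 𝒢.graph.Vertex} (P : D.PointSeq h𝒢 w)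

/-- **Uniform vanishing of `p^M`-th powers at a level**: for a homomorphism `F : ℤ_p → Π_w` and
`M ≥ #(S_n)_w`, the level-`n` decomposition map kills `F(p^M t)` (the element lies in every open subgroup of
index `≤ #(S_n)_w`, hence in the characteristic open core, which fixes the points of `𝒢_{∞,n}`).
[cite: MochizukiSemiAnbd2006, Thm 3.7(iii) p.41] -/
theorem gal_apply_ofAdd_pow_mul_eq_one (n : ℕ) [Finite ((D.S n).SV w).obj.V]
    (F : Multiplicative ℤ_[p] →* 𝒢.Gv w) {M : ℕ} (hM : Nat.card ((D.S n).SV w).obj.V ≤ M) (t : ℤ_[p]) :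
    P.gal n (F (ofAdd ((p : ℤ_[p]) ^ M * t))) = 1 := by
  apply P.gal_eq_one_of_mem_charOpenCore
  rw [charOpenCore, Subgroup.mem_sInf]
  intro S hS
  rw [mem_openSubgroupsIndexLE] at hS
  exact PadicIntLevels.ofAdd_pow_mul_mem_comap F hS.2.1.ne' (hS.2.2.trans hM) t

end GaloisLevelData.PointSeq

/-! ### The leaf point sequences of `𝒢⋆(p)` -/

variable (p : ℕ) [hp : Fact p.Prime]

/-- The branch `(n, true)` abuts to the centre. [cite: MochizukiSemiAnbd2006, §1 p.11] -/
theorem leafStar_abuts_true' (n : ℕ) :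
    (metabelianLeafStar p).graph.abuts ((n, true) : ℕ × Bool) = some (leafStarCentre p) := rfl

/-- The branch `(n, false)` abuts to the leaf `n`. [cite: MochizukiSemiAnbd2006, §1 p.11] -/
theorem leafStar_abuts_false' (n : ℕ) :
    (metabelianLeafStar p).graph.abuts ((n, false) : ℕ × Bool) = some (leafStarLeaf p n) := rfl

/-- Both branches `(n, false)`, `(n, true)` are branches of the edge `n`. [cite: MochizukiSemiAnbd2006, §1 p.11] -/
theorem leafStar_edgeOf_false_eq_true (n : ℕ) :
    (metabelianLeafStar p).graph.edgeOf ((n, false) : ℕ × Bool) =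
      (metabelianLeafStar p).graph.edgeOf ((n, true) : ℕ × Bool) := rfl

section Escape

variable {p} {h36 : (metabelianLeafStar p).Prop36Hypotheses}
  (P₀ : ((metabelianLeafStar p).galoisLevelData h36).PointSeq h36.isCountable (leafStarCentre p))

/-- **The leaf point sequence `P_n`**: un-glue `P₀` along the centre branch `(n, true)` and glue back along
the leaf branch `(n, false)`. [cite: MochizukiSemiAnbd2006, Thm 3.7(iii) p.41] -/
def leafSeq (n : ℕ) : ((metabelianLeafStar p).galoisLevelData h36).PointSeq h36.isCountable (leafStarLeaf p n) :=
  (P₀.toEdgeSeq ((n, true) : ℕ × Bool) (leafStar_abuts_true' p n)).gluePointSeq ((n, false) : ℕ × Bool)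
    (leafStarLeaf p n) (leafStar_abuts_false' p n) (leafStar_edgeOf_false_eq_true p n)

/-- The decomposition homomorphism `ψ_{P₀} : F̂₂⁽ᵖ⁾ → Π` at the centre (with its syntactic domain).
[cite: MochizukiSemiAnbd2006, Thm 3.7(i) p.40] -/
def psi0 : FreeProPRankTwo.Grp p →* ((metabelianLeafStar p).galoisLevelData h36).temperedPi h36.isCountable :=
  P₀.decompHom

/-- The decomposition homomorphism `ψ_{P_n} : Leaf n → Π` at the leaf `n`. [cite: MochizukiSemiAnbd2006, Thm 3.7(i) p.40] -/
def psiLeaf (n : ℕ) : Iw.Leaf (p := p) n →* ((metabelianLeafStar p).galoisLevelData h36).temperedPi h36.isCountable :=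
  (leafSeq P₀ n).decompHom

/-- Level components of `ψ_{P₀}`. [cite: MochizukiSemiAnbd2006, Thm 3.7(i) p.40] -/
theorem proj_psi0 (j : ℕ) (g : FreeProPRankTwo.Grp p) :
    ((metabelianLeafStar p).galoisLevelData h36).proj h36.isCountable j (psi0 P₀ g) = P₀.gal j g := rfl

/-- Level components of `ψ_{P_n}`. [cite: MochizukiSemiAnbd2006, Thm 3.7(i) p.40] -/
theorem proj_psiLeaf (n j : ℕ) (x : Iw.Leaf (p := p) n) :
    ((metabelianLeafStar p).galoisLevelData h36).proj h36.isCountable j (psiLeaf P₀ n x) =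
      (leafSeq P₀ n).gal j x := rfl

/-- **The gluing relation** `ψ_{P_n} ∘ lowHom n = ψ_{P₀} ∘ θα p n`. [cite: MochizukiSemiAnbd2006, Thm 3.7(iii) p.41] -/
theorem psiLeaf_lowHom (n : ℕ) (t : Multiplicative ℤ_[p]) :
    psiLeaf P₀ n (Iw.lowHom n t) = psi0 P₀ (FreeProPRankTwo.θα p n t) := by
  have h1 := (P₀.toEdgeSeq ((n, true) : ℕ × Bool) (leafStar_abuts_true' p n)).decompHomE_apply_of_eq
    h36.isConnected ((n, false) : ℕ × Bool) (leafStarLeaf p n) (leafStar_abuts_false' p n)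
    (leafStar_edgeOf_false_eq_true p n) t
  have h2 := DFunLike.congr_fun (P₀.decompHomE_toEdgeSeq ((n, true) : ℕ × Bool) (leafStar_abuts_true' p n)
    h36.isConnected) t
  exact (h1.symm.trans h2 :)

/-- `ψ_{P_n}(sig n) = ψ_{P₀}(a·b^{pⁿ})`. [cite: MochizukiSemiAnbd2006, Thm 3.7(iii) p.41] -/
theorem psiLeaf_sigLeaf (n : ℕ) :
    psiLeaf P₀ n (Iw.sigLeaf n) = psi0 P₀ (FreeProPRankTwo.a p * FreeProPRankTwo.b p ^ p ^ n) := by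
  have h : Iw.sigLeaf (p := p) n = Iw.lowHom n (ofAdd 1) := by
    rw [show (ofAdd (1 : ℤ_[p])) = ofAdd ((1 : ℤ) : ℤ_[p]) by rw [Int.cast_one], Iw.lowHom_ofAdd_intCast,
      zpow_one]
  rw [h, psiLeaf_lowHom, FreeProPRankTwo.θα_ofAdd_one]

/-! ### The elements `y`, `m_n`, `h_k`, `c_k` -/

/-- `y := ψ_{P₀}(a)`. [cite: MochizukiSemiAnbd2006, Thm 3.7(iii) p.41] -/
def escY : ((metabelianLeafStar p).galoisLevelData h36).temperedPi h36.isCountable := psi0 P₀ (FreeProPRankTwo.a p)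

/-- `m_n := ψ_{P_n}(transl)` — the unit translation of the leaf `n`, read in `Π`.
[cite: MochizukiSemiAnbd2006, Thm 3.7(iii) p.41] -/
def escM (n : ℕ) : ((metabelianLeafStar p).galoisLevelData h36).temperedPi h36.isCountable :=
  psiLeaf P₀ n (Iw.translLeaf n)

/-- `h_k := m_0 m_1 ⋯ m_k`. [cite: MochizukiSemiAnbd2006, Thm 3.7(iii) p.41] -/
def escH : ℕ → ((metabelianLeafStar p).galoisLevelData h36).temperedPi h36.isCountable
  | 0 => escM P₀ 0
  | k + 1 => escH k * escM P₀ (k + 1)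

/-- `c_k := h_k y h_k⁻¹`. [cite: MochizukiSemiAnbd2006, Thm 3.7(iii) p.41] -/
def escC (k : ℕ) : ((metabelianLeafStar p).galoisLevelData h36).temperedPi h36.isCountable :=
  escH P₀ k * escY P₀ * (escH P₀ k)⁻¹

/-- `h_{k+1} = h_k m_{k+1}`. [cite: MochizukiSemiAnbd2006, Thm 3.7(iii) p.41] -/
theorem escH_succ (k : ℕ) : escH P₀ (k + 1) = escH P₀ k * escM P₀ (k + 1) := rfl

/-- `c_{k+1} = h_k (m_{k+1} y m_{k+1}⁻¹) h_k⁻¹`. [cite: MochizukiSemiAnbd2006, Thm 3.7(iii) p.41] -/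
theorem escC_succ (k : ℕ) :
    escC P₀ (k + 1) = escH P₀ k * (escM P₀ (k + 1) * escY P₀ * (escM P₀ (k + 1))⁻¹) * (escH P₀ k)⁻¹ := by
  rw [escC, escH_succ, mul_inv_rev]
  simp only [mul_assoc]

/-! ### The level bound `N_j` and the uniform vanishing of `p^{N_j}`-th powers -/

variable (h36) in
/-- The level bound `N_j := #(S_j)_{centre}` (the common cardinality of all vertex fibres of the finite
Galois level `S_j`). [cite: MochizukiSemiAnbd2006, Prop 3.6 p.38] -/
def lvl (j : ℕ) : ℕ :=
  Nat.card ((((metabelianLeafStar p).galoisLevelData h36).S j).SV (leafStarCentre p)).obj.V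

/-- Every vertex fibre of `S_j` has `N_j` points (`𝒢⋆(p)` is connected; the gluings are bijections).
[cite: MochizukiSemiAnbd2006, §3 p.36] -/
theorem card_SV_eq_lvl (j : ℕ) (v : (metabelianLeafStar p).graph.Vertex) :
    Nat.card ((((metabelianLeafStar p).galoisLevelData h36).S j).SV v).obj.V = lvl h36 j :=
  (((metabelianLeafStar p).galoisLevelData h36).S j).nodeCard_eq_of_reachable
    (SemiGraph.leafStar_isConnected.connected.preconnected (Sum.inl v) (Sum.inl (leafStarCentre p)))

/-- The vertex fibres of `S_j` are finite. [cite: MochizukiSemiAnbd2006, Prop 3.6 p.38] -/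
theorem finite_SV (j : ℕ) (v : (metabelianLeafStar p).graph.Vertex) :
    Finite ((((metabelianLeafStar p).galoisLevelData h36).S j).SV v).obj.V :=
  ((metabelianLeafStar p).galoisLevelData_isFinite h36 j).finite_V v

/-- `(p:ℤ_p)^N · p^(k−N) = p^k` (cast from `ℕ` via `ℤ`). [cite: RibesZalesskii2010, §4.1] -/
theorem padic_pow_mul_pow_sub {N k : ℕ} (hk : N ≤ k) :
    (p : ℤ_[p]) ^ N * (p : ℤ_[p]) ^ (k - N) = (((p ^ k : ℕ) : ℤ) : ℤ_[p]) := by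
  rw [← pow_add, Nat.add_sub_cancel' hk]; push_cast; rfl

/-- `σ_j(transl^{p^k}) = 1` at every leaf, for `k ≥ N_j`. [cite: MochizukiSemiAnbd2006, Thm 3.7(iii) p.41] -/
theorem gal_leafSeq_translLeaf_pow (n j k : ℕ) (hk : lvl h36 j ≤ k) :
    (leafSeq P₀ n).gal j (Iw.translLeaf n ^ p ^ k) = 1 := by
  haveI := finite_SV (h36 := h36) j (leafStarLeaf p n)
  have h := (leafSeq P₀ n).gal_apply_ofAdd_pow_mul_eq_one j (Iw.translHom (p := p) n)
    (card_SV_eq_lvl j _).le ((p : ℤ_[p]) ^ (k - lvl h36 j))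
  have e : Iw.translHom (p := p) n (ofAdd ((p : ℤ_[p]) ^ lvl h36 j * (p : ℤ_[p]) ^ (k - lvl h36 j))) =
      Iw.translLeaf n ^ p ^ k := by
    rw [padic_pow_mul_pow_sub hk, Iw.translHom_ofAdd_intCast, zpow_natCast]
  exact (congrArg ((leafSeq P₀ n).gal j) e).symm.trans h

/-- `σ_j(g^{p^k}) = 1` at the centre, for every `g ∈ F̂₂⁽ᵖ⁾` and `k ≥ N_j` (via the `ℤ_p`-power map `zpow g`).
[cite: MochizukiSemiAnbd2006, Thm 3.7(iii) p.41] -/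
theorem gal_P₀_pow (g : FreeProPRankTwo.Grp p) (j k : ℕ) (hk : lvl h36 j ≤ k) : P₀.gal j (g ^ p ^ k) = 1 := by
  haveI := finite_SV (h36 := h36) j (leafStarCentre p)
  have h := P₀.gal_apply_ofAdd_pow_mul_eq_one j (FreeProPRankTwo.zpow p g).toMonoidHom
    (M := lvl h36 j) le_rfl ((p : ℤ_[p]) ^ (k - lvl h36 j))
  have e : (FreeProPRankTwo.zpow p g).toMonoidHom
      (ofAdd ((p : ℤ_[p]) ^ lvl h36 j * (p : ℤ_[p]) ^ (k - lvl h36 j))) = g ^ p ^ k := by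
    rw [padic_pow_mul_pow_sub hk, Int.cast_natCast]
    exact FreeProPRankTwo.zpow_ofAdd_natCast p g (p ^ k)
  exact (congrArg (P₀.gal j) e).symm.trans h

/-! ### Level-wise eventual constancy of `c_k` -/

/-- **The engine in the leaf**: `transl · sig n · transl⁻¹ = (transl^{p^{n+1}})⁻¹ · sig n`.
[cite: MochizukiSemiAnbd2006, Def 2.4(iv) p.26] -/
theorem translLeaf_mul_sigLeaf_mul_inv (n : ℕ) :
    Iw.translLeaf (p := p) n * Iw.sigLeaf n * (Iw.translLeaf n)⁻¹ =
      (Iw.translLeaf n ^ p ^ (n + 1))⁻¹ * Iw.sigLeaf n := by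
  apply Subtype.ext
  change Iw.transl * Iw.sig (p := p) n * Iw.transl⁻¹ =
    ((Iw.translLeaf (p := p) n ^ p ^ (n + 1) : Iw.Leaf (p := p) n) : Iw p)⁻¹ * Iw.sig n
  rw [Subgroup.coe_pow]
  change Iw.transl * Iw.sig (p := p) n * Iw.transl⁻¹ = (Iw.transl ^ p ^ (n + 1))⁻¹ * Iw.sig n
  rw [← Iw.sig_mul_transl_mul_sig_inv_mul_transl_inv (p := p) n]
  group

/-- At level `j`, conjugating `y` by `m_n` does not change its image once `n ≥ N_j`:
`ρ_j(m_n y m_n⁻¹) = ρ_j(y)`. [cite: MochizukiSemiAnbd2006, Thm 3.7(iii) p.41] -/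
theorem proj_escM_conj_escY (n j : ℕ) (hn : lvl h36 j ≤ n) :
    ((metabelianLeafStar p).galoisLevelData h36).proj h36.isCountable j (escM P₀ n * escY P₀ * (escM P₀ n)⁻¹) =
      ((metabelianLeafStar p).galoisLevelData h36).proj h36.isCountable j (escY P₀) := by
  set π := ((metabelianLeafStar p).galoisLevelData h36).proj h36.isCountable j with hπ
  -- `y = s · β⁻¹` with `s = ψ_{P_n}(sig n)`, `β = ψ_{P₀}(b^{pⁿ})`
  have ha : FreeProPRankTwo.a p =
      FreeProPRankTwo.a p * FreeProPRankTwo.b p ^ p ^ n * (FreeProPRankTwo.b p ^ p ^ n)⁻¹ :=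
    (mul_inv_cancel_right _ _).symm
  have hy : escY P₀ = psiLeaf P₀ n (Iw.sigLeaf n) * (psi0 P₀ (FreeProPRankTwo.b p ^ p ^ n))⁻¹ := by
    rw [psiLeaf_sigLeaf, ← map_inv, ← map_mul, ← ha]; rfl
  have hβ : π (psi0 P₀ (FreeProPRankTwo.b p ^ p ^ n)) = 1 := by
    rw [hπ, proj_psi0]; exact gal_P₀_pow P₀ _ j n hn
  have hτ : π (psiLeaf P₀ n (Iw.translLeaf n ^ p ^ (n + 1))) = 1 := by
    rw [hπ, proj_psiLeaf]; exact gal_leafSeq_translLeaf_pow P₀ n j (n + 1) (hn.trans (Nat.le_succ n))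
  have hconj : escM P₀ n * psiLeaf P₀ n (Iw.sigLeaf n) * (escM P₀ n)⁻¹ =
      (psiLeaf P₀ n (Iw.translLeaf n ^ p ^ (n + 1)))⁻¹ * psiLeaf P₀ n (Iw.sigLeaf n) := by
    rw [escM, ← map_inv, ← map_mul, ← map_mul, translLeaf_mul_sigLeaf_mul_inv, map_mul, map_inv]
  -- push `π` through
  rw [hy]
  rw [show escM P₀ n * (psiLeaf P₀ n (Iw.sigLeaf n) * (psi0 P₀ (FreeProPRankTwo.b p ^ p ^ n))⁻¹) *
      (escM P₀ n)⁻¹ = (escM P₀ n * psiLeaf P₀ n (Iw.sigLeaf n) * (escM P₀ n)⁻¹) *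
      (escM P₀ n * (psi0 P₀ (FreeProPRankTwo.b p ^ p ^ n))⁻¹ * (escM P₀ n)⁻¹) by group]
  rw [hconj, map_mul, map_mul, map_mul, map_mul, map_mul, map_inv, map_inv, map_inv, hβ, hτ]
  group

/-- **`ρ_j(c_{k+1}) = ρ_j(c_k)` for `k + 1 ≥ N_j`.** [cite: MochizukiSemiAnbd2006, Thm 3.7(iii) p.41] -/
theorem proj_escC_succ (j k : ℕ) (hk : lvl h36 j ≤ k + 1) :
    ((metabelianLeafStar p).galoisLevelData h36).proj h36.isCountable j (escC P₀ (k + 1)) =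
      ((metabelianLeafStar p).galoisLevelData h36).proj h36.isCountable j (escC P₀ k) := by
  rw [escC_succ, map_mul, map_mul, proj_escM_conj_escY P₀ (k + 1) j hk, ← map_mul, ← map_mul]
  rfl

/-- **(hz)** for `c_k`: at every level the images `ρ_j(c_k)` are eventually constant.
[cite: MochizukiSemiAnbd2006, Thm 3.7(iii) p.41] -/
theorem escC_hz : ∀ j : ℕ, ∃ N : ℕ, ∀ k, N ≤ k →
    ((metabelianLeafStar p).galoisLevelData h36).projAut h36.isCountable j (escC P₀ (k + 1)) =
      ((metabelianLeafStar p).galoisLevelData h36).projAut h36.isCountable j (escC P₀ k) :=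
  fun j => ⟨lvl h36 j, fun k hk => proj_escC_succ P₀ j k (hk.trans (Nat.le_succ k))⟩

/-- **(hfin)** `ρ_j(c_k)` has finite order (a conjugate of `ρ_j(y) = σ_j(a)`, killed by `p^{N_j}`).
[cite: MochizukiSemiAnbd2006, Thm 3.7(iii) p.41] -/
theorem isOfFinOrder_proj_escC (j k : ℕ) :
    IsOfFinOrder (((metabelianLeafStar p).galoisLevelData h36).projAut h36.isCountable j (escC P₀ k)) := by
  refine isOfFinOrder_iff_pow_eq_one.2 ⟨p ^ lvl h36 j, pow_pos hp.out.pos _, ?_⟩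
  have hy : ((metabelianLeafStar p).galoisLevelData h36).projAut h36.isCountable j (escY P₀ ^ p ^ lvl h36 j) = 1 := by
    change ((metabelianLeafStar p).galoisLevelData h36).proj h36.isCountable j
      (psi0 P₀ (FreeProPRankTwo.a p) ^ p ^ lvl h36 j) = 1
    rw [← map_pow, proj_psi0]
    exact gal_P₀_pow P₀ _ j _ le_rfl
  rw [← map_pow, escC, conj_pow, map_mul, map_mul, hy, mul_one, map_inv, mul_inv_cancel]

/-- **The escaping element**: some `c ∈ π₁^temp(𝒢⋆(p))` has `ρ_j(c) = ρ_j(c_k)` for all `k ≥ N'_j`; the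
closed procyclic subgroup `⟨c⟩‾` is COMPACT, and `c` acts on every level tree like `c_k`, `k ≥ N'_j`.
[cite: MochizukiSemiAnbd2006, Thm 3.7(iii) p.41] -/
theorem exists_escapeLimit :
    ∃ (c : ((metabelianLeafStar p).galoisLevelData h36).temperedPi h36.isCountable) (N : ℕ → ℕ),
      (∀ j k, N j ≤ k → ((metabelianLeafStar p).galoisLevelData h36).proj h36.isCountable j c =
        ((metabelianLeafStar p).galoisLevelData h36).proj h36.isCountable j (escC P₀ k)) ∧
      IsCompact ((Subgroup.zpowers c).topologicalClosure :
        Set (((metabelianLeafStar p).galoisLevelData h36).temperedPi h36.isCountable)) ∧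
      (∀ j k, N j ≤ k → ((metabelianLeafStar p).galoisLevelData h36).treeAct h36.isCountable j c =
        ((metabelianLeafStar p).galoisLevelData h36).treeAct h36.isCountable j (escC P₀ k)) := by
  obtain ⟨c, hc⟩ := ((metabelianLeafStar p).galoisLevelData h36).exists_forall_eventually_projAut_eq
    h36.isCountable (escC P₀) (escC_hz P₀)
  choose N hN using hc
  have hford : ∀ j, IsOfFinOrder (((metabelianLeafStar p).galoisLevelData h36).projAut h36.isCountable j c) :=
    fun j => by rw [hN j (N j) le_rfl]; exact isOfFinOrder_proj_escC P₀ j (N j)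
  refine ⟨c, N, fun j k hk => hN j k hk,
    ((metabelianLeafStar p).galoisLevelData h36).isCompact_topologicalClosure_zpowers h36.isCountable c hford,
    fun j k hk => ?_⟩
  rw [GaloisLevelData.treeAct_apply, GaloisLevelData.treeAct_apply]
  exact congrArg _ (hN j k hk)

end Escape

end ProfiniteSemiGraph

end Literature.AnabelianGeometry.SemiGraphs

end
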